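import Summits.NavierStokesRegularity.NavierStokesRegularity.Theorems.LerayQuarterDissipationRecurrentReductionDRecurrent
import Summits.NavierStokesRegularity.NavierStokesRegularity.Theorems.ClockStretchingLawClockLawStubLimitSingular
import Summits.NavierStokesRegularity.NavierStokesRegularity.Theorems.ClockStretchingLawClockLawStubClassPressure
import HarnessLib

/-!
# Route `LerayQuarterDissipation`, item `RecurrentReductionD` (stmt-NavierStokesRegularity-22507):
# the recurrent reduction for profiles carrying the scale-invariant energy ledger

Helper file (theorems only, `--supports` the item). The Birkhoff reduction of
`LerayQuarterDissipationRecurrentReductionDRecurrent.lean` (`exists_recurrent_of_persistent`)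
produces a uniformly recurrent singular element of the finite-dissipation stratum
`𝒟_{C,K}` from any singular element of `𝒟_{C,K}` ALONG WHOSE SCALING ORBIT THE APEX
SINGULARITY PERSISTS in the limit. For elements which carry, in addition to the Type-I rate
and the quarter-rate dissipation law, the scale-invariant local energy ledger
`A(Q(z,r)), E(Q(z,r)) ≤ C` on all backward cylinders with vertex time `≤ 0` — the Type-I model
class `𝒦_C` of routes SqueezeCycle / ClockStretchingLaw, in which every zoom limit of the
finite-energy blow-ups lands (`singularZoom_zoomLimit`) — persistence is the tree's
`stub_limitSingular` (Rusin–Šverák 2011; Albritton–Barker 2019, Lemma 2.2 and Prop. 2.3, fed by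
`classPressure_holds`). Hence:

* `recurrentReductionD_of_energyLedger` — **RecurrentReductionD for ledger-carrying
  profiles**: a singular element of `𝒟_{C,K} ∩ 𝒦_C` yields a singular, uniformly recurrent
  element of `𝒟_{C,K}` (same constants).

This is the item's statement with ONE extra hypothesis (the ledger on the given profile); the
item as filed (no ledger) needs persistence of the apex singularity for the bare class `𝒟`,
which is the object of the remaining files of this series.

References: H. Furstenberg (1981), Thm. 1.16 [Furstenberg1981]; D. Albritton, T. Barker,
arXiv:1811.00502, Lemma 2.2, Prop. 2.3 [AlbrittonBarker2019]; G. Koch, N. Nadirashvili,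
G. Seregin, V. Šverák, arXiv:0709.3599 [KochNadirashviliSereginSverak2009].
-/

noncomputable section

-- the summit and its single problem share the name (D-0017 nested layout)
set_option linter.dupNamespace false

namespace Summit.NavierStokesRegularity.NavierStokesRegularity.Theorems.RecurrentReductionD

open scoped Topology
open MeasureTheory Set Function Filter Metric
open Literature.Analysis.FluidPDE
open Summit.NavierStokesRegularity.NavierStokesRegularity.Theorems.AdaptedFrequencyConverges.BirkhoffRecurrentHull
open Summit.NavierStokesRegularity.NavierStokesRegularity.Theorems.ClockLaw.Birth
open scoped ENNReal NNReal

/-- **Persistence of the apex singularity along the scaling orbit of a ledger-carrying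
profile**: if `u` is a Type-I ancient mild field with the energy ledger `A, E ≤ C` which exceeds
every bound on every backward cylinder at the origin, then so does every pointwise limit (on the
open slab) of rescalings `u_{l_k}`, `l_k > 0` (the tree's `stub_limitSingular` with
`classPressure_holds`; `nsRescale l u = l • stPull l² l 0 0 u`).
[cite: AlbrittonBarker2019, Lemma 2.2 and Prop. 2.3] -/
theorem persistent_of_energyLedger {C : ℝ}
    {u : ℝ → EuclideanSpace ℝ (Fin 3) → EuclideanSpace ℝ (Fin 3)} (hu : IsTypeIAncientMild C u)
    (hE : ∀ (x₀ : EuclideanSpace ℝ (Fin 3)) (t₀ r : ℝ), t₀ ≤ 0 → 0 < r →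
      (∀ t, t₀ - r ^ 2 < t → t < t₀ → r⁻¹ * ∫ x in Metric.ball x₀ r, ‖u t x‖ ^ 2 ≤ C) ∧
        r⁻¹ * ∫ t in Set.Ioo (t₀ - r ^ 2) t₀, ∫ x in Metric.ball x₀ r, ‖fderiv ℝ (u t) x‖ ^ 2 ≤ C)
    (hsing : ∀ r > 0, ∀ M : ℝ, ∃ t ∈ Ioo (-(r ^ 2)) (0 : ℝ),
      ∃ x ∈ ball (0 : EuclideanSpace ℝ (Fin 3)) r, M < ‖u t x‖)
    (l : ℕ → ℝ) (hl : ∀ k, 0 < l k)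
    (W : ℝ → EuclideanSpace ℝ (Fin 3) → EuclideanSpace ℝ (Fin 3))
    (hconv : ∀ t < 0, ∀ x, Tendsto (fun k => nsRescale (l k) u t x) atTop (𝓝 (W t x))) :
    ∀ r > 0, ∀ M : ℝ, ∃ t ∈ Ioo (-(r ^ 2)) (0 : ℝ),
      ∃ x ∈ ball (0 : EuclideanSpace ℝ (Fin 3)) r, M < ‖W t x‖ := by
  refine stub_limitSingular classPressure_holds C u hu hE hsing l hl W fun t ht x => ?_
  refine (hconv t ht x).congr fun k => ?_
  rw [nsRescale_eq_smul_stPull]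

/-- **RecurrentReductionD for ledger-carrying profiles.** If a Type-I ancient mild field `ū`
(KNSS gauge, constant `C`) with the global quarter-rate dissipation law
`∫‖∇ū(s)‖² ≤ K/√(−s)` AND the scale-invariant energy ledger `A, E ≤ C` on all backward
cylinders with vertex time `≤ 0` exceeds every bound on every backward cylinder at the origin,
then some Type-I ancient mild field with the same constant and the same law is uniformly
recurrent under the scaling flow `σ ↦ e^σ w(e^{2σ}s, e^σ y)` (uniformly on
`[−R², −R⁻²] × B̄(0, R)`, relatively dense log-scales) and exceeds every bound on every backward
cylinder at the origin (`exists_recurrent_of_persistent` + `persistent_of_energyLedger`).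
[cite: Furstenberg1981, Ch. 1 §4, Thm. 1.16] -/
theorem recurrentReductionD_of_energyLedger (C K : ℝ)
    (ū : ℝ → EuclideanSpace ℝ (Fin 3) → EuclideanSpace ℝ (Fin 3))
    (hu : IsTypeIAncientMild C ū)
    (hlaw : ∀ s : ℝ, s < 0 → ∫⁻ x, ‖fderiv ℝ (ū s) x‖ₑ ^ 2 ≤ ENNReal.ofReal (K / Real.sqrt (-s)))
    (hE : ∀ (x₀ : EuclideanSpace ℝ (Fin 3)) (t₀ r : ℝ), t₀ ≤ 0 → 0 < r →
      (∀ t, t₀ - r ^ 2 < t → t < t₀ → r⁻¹ * ∫ x in Metric.ball x₀ r, ‖ū t x‖ ^ 2 ≤ C) ∧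
        r⁻¹ * ∫ t in Set.Ioo (t₀ - r ^ 2) t₀, ∫ x in Metric.ball x₀ r, ‖fderiv ℝ (ū t) x‖ ^ 2 ≤ C)
    (hsing : ∀ r > 0, ∀ M : ℝ, ∃ t ∈ Ioo (-(r ^ 2)) (0 : ℝ),
      ∃ x ∈ ball (0 : EuclideanSpace ℝ (Fin 3)) r, M < ‖ū t x‖) :
    ∃ (C' K' : ℝ) (w : ℝ → EuclideanSpace ℝ (Fin 3) → EuclideanSpace ℝ (Fin 3)),
      IsTypeIAncientMild C' w ∧
      (∀ s : ℝ, s < 0 → ∫⁻ x, ‖fderiv ℝ (w s) x‖ₑ ^ 2 ≤ ENNReal.ofReal (K' / Real.sqrt (-s))) ∧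
      (∀ ε > 0, ∀ R > 1, ∃ L > 0, ∀ a : ℝ, ∃ σ ∈ Icc a (a + L),
        ∀ s ∈ Icc (-(R ^ 2)) (-(R⁻¹) ^ 2), ∀ y ∈ closedBall (0 : EuclideanSpace ℝ (Fin 3)) R,
          ‖Real.exp σ • w (Real.exp (2 * σ) * s) (Real.exp σ • y) - w s y‖ ≤ ε) ∧
      (∀ r > 0, ∀ M : ℝ, ∃ t ∈ Ioo (-(r ^ 2)) (0 : ℝ),
        ∃ x ∈ ball (0 : EuclideanSpace ℝ (Fin 3)) r, M < ‖w t x‖) := by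
  obtain ⟨w, hw, hlaww, hrec, hsingw⟩ := exists_recurrent_of_persistent hu hlaw
    fun l hl W _ hconv => persistent_of_energyLedger hu hE hsing l hl W hconv
  exact ⟨C, K, w, hw, hlaww, hrec, hsingw⟩

end Summit.NavierStokesRegularity.NavierStokesRegularity.Theorems.RecurrentReductionD

end
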